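import Literature.NumberTheory.EllipticCurves.EisensteinWeightOneCusps
import Literature.NumberTheory.EllipticCurves.Gamma0EisensteinWeightOneContinuation
import Literature.NumberTheory.EllipticCurves.RankinSelbergDomainHolomorphy
import Literature.NumberTheory.Automorphic.MeasurableAnalyticContinuation
import HarnessLib

/-!
# Hecke's continued weight-one Eisenstein series on the whole upper half-plane: measurability,
growth at every cusp and globally, holomorphy of its Rankin–Selberg integrals

Topic `Literature/NumberTheory/EllipticCurves`; namespace
`Literature.NumberTheory.EllipticCurves.ModularForms`. Theorems only; no definition, no named fact.

For an odd Dirichlet character `χ mod M` and Hecke's continuation `G̃_χ(z, s) = eisensteinOneCont χ z s`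
of `L(χ, 1+2s) E₁,χ(z, s)` to `Re s > -1/2` (`Gamma0EisensteinWeightOneContinuation`), this file turns
the cusp-by-cusp analysis of `EisensteinWeightOneCusps` (`G̃(Bz, s) = j(B, z) Σ_{v₀} W_B(v₀)
congrCont(z, s; v₀)` with box bounds uniform in `B ∈ SL(2, ℤ)`) into the three inputs of the
Rankin–Selberg holomorphy theorem `differentiableOn_integral_domain_rsKernel`
(`RankinSelbergDomainHolomorphy`):

* `measurable_eisensteinOneCont` — `z ↦ G̃_χ(z, s)` is Borel measurable for every `Re s > -1/2`
  (continuity on `Re s > 1/2`, then `measurable_of_differentiableOn_re`: analytic continuation in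
  `s` preserves measurability in `z`);
* `exists_bound_eisensteinOneCont_smul_box` — at the cusp `B∞`:
  `‖G̃(Bz, s)‖ ≤ |j(B, z)| C (y^{A} + y^{-A})` on boxes in `s`, uniformly in `B`;
* `exists_bound_eisensteinOneCont_mul_sqrt_box` — the weight-one normalised form
  `‖G̃(τ, s)‖ (Im τ)^{1/2} ≤ C (v^{A} + v^{-A})`, `v = Im(gτ)`, for every `g ∈ SL(2, ℤ)` and `τ ∈ ℍ`;
* `exists_bound_eisensteinOneCont_global_box` — **global polynomial bound**
  `‖G̃(τ, s)‖ ≤ C ((Im τ)^{B} + (Im τ)^{-B})` on all of `ℍ` (reduction to `𝒟`: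
  `1/2 < Im(gτ) ≤ max(Im τ, 1/Im τ)`, `im_smul_le_max`);
* `differentiableOn_rsIntegral_eisensteinOneCont`,
  `differentiableOn_rsIntegral_eisensteinOneCont_pair` — **holomorphy on `Re s > -1/2` of
  `s ↦ ∫_F \overline{G̃_ψ(τ, s̄)} f(τ) \overline{F(τ)} y² dμ`** for a weight-`2` cusp form `f` of
  arithmetic level and `F` of moderate growth at every cusp, in particular for
  `F = G̃_{χ'}(·, 0)` (a holomorphic weight-one Eisenstein series of another level).

Everything is proved. [folklore] (Hecke 1927, §2; Rankin 1939, §4; Shimura 1976, §2.)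

## References

* E. Hecke, Abh. Math. Sem. Hamburg 5 (1927), 199–224, §2.
* R. A. Rankin, Proc. Cambridge Philos. Soc. 35 (1939), 357–372, §4.
* G. Shimura, Comm. Pure Appl. Math. 29 (1976), 783–804, §2.
-/

noncomputable section

open scoped MatrixGroups ModularForm Modular Real Topology ComplexConjugate
open UpperHalfPlane hiding I
open MeasureTheory Set Filter Metric ModularGroup CongruenceSubgroup Complex

namespace Literature.NumberTheory.EllipticCurves.ModularForms

variable {M : ℕ} (χ : DirichletCharacter ℂ M)

/-! ### Elementary geometry of `SL(2, ℤ)` on `ℍ` -/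

/-- `Im(gτ) ≤ max(Im τ, 1/Im τ)`: `Im(gτ) = y/|cτ+d|²` is `y` if `c = 0` and at most `1/y` otherwise.
[folklore] -/
theorem im_smul_le_max (g : SL(2, ℤ)) (τ : ℍ) : (g • τ).im ≤ max τ.im τ.im⁻¹ := by
  have hy := τ.im_pos
  rw [ModularGroup.im_smul_eq_div_normSq, ModularGroup.denom_apply]
  have hns : Complex.normSq ((g 1 0 : ℂ) * τ + g 1 1) =
      ((g 1 0 : ℝ) * τ.re + g 1 1) ^ 2 + ((g 1 0 : ℝ) * τ.im) ^ 2 := by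
    rw [Complex.normSq_apply]
    simp [sq]
  rw [hns]
  by_cases hc : g 1 0 = 0
  · have hdet := g.det_coe
    rw [Matrix.det_fin_two, hc, mul_zero, sub_zero] at hdet
    have hd : g 1 1 = 1 ∨ g 1 1 = -1 := Int.eq_one_or_neg_one_of_mul_eq_one' hdet |>.elim
      (fun h1 ↦ Or.inl h1.2) (fun h1 ↦ Or.inr h1.2)
    have hd2 : ((g 1 1 : ℤ) : ℝ) ^ 2 = 1 := by
      rcases hd with hd | hd <;> simp [hd]
    simp only [hc, Int.cast_zero, zero_mul, zero_add, zero_pow, ne_eq, OfNat.ofNat_ne_zero,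
      not_false_eq_true, add_zero, hd2, div_one]
    exact le_max_left _ _
  · have hc1 : (1 : ℝ) ≤ ((g 1 0 : ℤ) : ℝ) ^ 2 := by
      have : 1 ≤ (g 1 0) ^ 2 := by
        have h0 : g 1 0 ≠ 0 := hc
        nlinarith [sq_nonneg (g 1 0), Int.one_le_abs h0, sq_abs (g 1 0)]
      exact_mod_cast this
    have hden : τ.im ^ 2 ≤ ((g 1 0 : ℝ) * τ.re + g 1 1) ^ 2 + ((g 1 0 : ℝ) * τ.im) ^ 2 := by
      nlinarith [sq_nonneg ((g 1 0 : ℝ) * τ.re + g 1 1), sq_nonneg τ.im]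
    calc τ.im / (((g 1 0 : ℝ) * τ.re + g 1 1) ^ 2 + ((g 1 0 : ℝ) * τ.im) ^ 2)
        ≤ τ.im / τ.im ^ 2 := div_le_div_of_nonneg_left hy.le (by positivity) hden
      _ = τ.im⁻¹ := by field_simp
      _ ≤ max τ.im τ.im⁻¹ := le_max_right _ _

/-- Points of `𝒟` have imaginary part `> 1/2`. [folklore] -/
theorem half_lt_im_of_mem_fd {z : ℍ} (hz : z ∈ 𝒟) : 1 / 2 < z.im := by
  have h := ModularGroup.three_le_four_mul_im_sq_of_mem_fd hz
  have hy := z.im_pos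
  nlinarith

/-- `√(Im(Bz)) · |j(B, z)| = √(Im z)` (`Im(Bz) = Im z / |j(B, z)|²`). [folklore] -/
theorem sqrt_im_smul_mul_norm_denom (B : SL(2, ℤ)) (z : ℍ) :
    Real.sqrt (B • z).im * ‖denom B z‖ = Real.sqrt z.im := by
  have hd : denom B z ≠ 0 := denom_ne_zero B z
  have hn : 0 < Complex.normSq (denom B z) := Complex.normSq_pos.mpr hd
  have h1 : Real.sqrt (Complex.normSq (denom B z)) = ‖denom B z‖ := by
    rw [← Complex.sq_norm, Real.sqrt_sq (norm_nonneg _)]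
  rw [ModularGroup.im_smul_eq_div_normSq, Real.sqrt_div' _ hn.le, h1,
    div_mul_cancel₀ _ (norm_ne_zero_iff.mpr hd)]

/-! ### Measurability in `z` on `Re s > -1/2` -/

section Measurable

variable [NeZero M]

/-- **`z ↦ G̃_χ(z, s)` is Borel measurable for `Re s > -1/2`** (odd `χ`): continuous for
`Re s > 1/2` (`G̃ = L(χ, 1+2s) E₁,χ`, `continuous_eisensteinOne`), holomorphic in `s`, hence
measurable on the whole half-plane by `measurable_of_differentiableOn_re`. [folklore] -/
theorem measurable_eisensteinOneCont (hodd : χ.Odd) {s : ℂ} (hs : -1 / 2 < s.re) :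
    Measurable fun z : ℍ => eisensteinOneCont χ z s := by
  have hχ : χ ≠ 1 := ne_one_of_odd χ hodd
  refine Automorphic.measurable_of_differentiableOn_re
    (G := fun s (z : ℍ) => eisensteinOneCont χ z s) (a := -1 / 2) (b := 1 / 2)
    (fun z => differentiableOn_eisensteinOneCont χ hχ z) (fun t ht => ?_) hs
  have h : (fun z : ℍ => eisensteinOneCont χ z t) =
      fun z => χ.LFunction (1 + 2 * t) * eisensteinOne χ z t :=
    funext fun z => eisensteinOneCont_eq_LFunction_mul χ hodd ht z
  rw [h]
  exact (continuous_const.mul (continuous_eisensteinOne χ ht)).measurable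

end Measurable

/-! ### Growth at every cusp, uniformly in the cusp -/

section Growth

variable [NeZero M]

/-- **`G̃` at the cusp `B∞` on boxes**: for odd `χ`, `-1/2 < a < b`, `0 < T` there are `C, A ≥ 0`
with `‖G̃_χ(Bz, s)‖ ≤ |j(B, z)| · C ((Im z)^A + (Im z)^{-A})` for all `B ∈ SL(2, ℤ)`, `z ∈ ℍ`,
`a < Re s < b`, `|Im s| < T` (the identity theorem at the cusp, `eq_sum_congrCont_of_eqOn`, and the
uniform box bound `exists_bound_sum_congrCont_box`). [folklore] -/
theorem exists_bound_eisensteinOneCont_smul_box (hodd : χ.Odd) {a b T : ℝ} (ha : -1 / 2 < a)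
    (hab : a < b) (hT : 0 < T) :
    ∃ C A : ℝ, 0 ≤ C ∧ 0 ≤ A ∧ ∀ (B : SL(2, ℤ)) (z : ℍ) (s : ℂ), a < s.re → s.re < b →
      |s.im| < T → ‖eisensteinOneCont χ (B • z) s‖ ≤ ‖denom B z‖ * (C * (z.im ^ A + z.im ^ (-A))) := by
  have hM : 0 < M := Nat.pos_of_ne_zero (NeZero.ne M)
  have hχ : χ ≠ 1 := ne_one_of_odd χ hodd
  obtain ⟨C, A, hC, hA, hb⟩ := exists_bound_sum_congrCont_box χ hM ha hab hT
  refine ⟨C, A, hC, hA, fun B z s hsa hsb hsT => ?_⟩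
  have hs : -1 / 2 < s.re := by linarith
  have heq := eq_sum_congrCont_of_eqOn χ hM B z (G := eisensteinOneCont χ (B • z))
    (differentiableOn_eisensteinOneCont χ hχ (B • z))
    (fun t ht => eisensteinOneCont_eq_eisensteinOneAll χ hodd ht (B • z)) hs
  rw [heq, norm_mul]
  exact mul_le_mul_of_nonneg_left (hb B s hsa hsb hsT z) (norm_nonneg _)

/-- **Weight-one normalised growth at every cusp**: for odd `χ` and a box in `s` there are
`C, A ≥ 0` with `‖G̃_χ(τ, s)‖ (Im τ)^{1/2} ≤ C (v^A + v^{-A})`, `v = Im(gτ)`, for every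
`g ∈ SL(2, ℤ)` and every `τ ∈ ℍ` (apply the previous bound at `B = g⁻¹`, `z = gτ`, and use
`√(Im τ) = √v / |j(g⁻¹, gτ)|`). [folklore] -/
theorem exists_bound_eisensteinOneCont_mul_sqrt_box (hodd : χ.Odd) {a b T : ℝ} (ha : -1 / 2 < a)
    (hab : a < b) (hT : 0 < T) :
    ∃ C A : ℝ, 0 ≤ C ∧ 0 ≤ A ∧ ∀ (g : SL(2, ℤ)) (τ : ℍ) (s : ℂ), a < s.re → s.re < b →
      |s.im| < T → ‖eisensteinOneCont χ τ s‖ * Real.sqrt τ.im ≤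
        C * ((g • τ).im ^ A + (g • τ).im ^ (-A)) := by
  obtain ⟨C, A, hC, hA, hb⟩ := exists_bound_eisensteinOneCont_smul_box χ hodd ha hab hT
  refine ⟨2 * C, A + 1 / 2, by positivity, by positivity, fun g τ s hsa hsb hsT => ?_⟩
  set σ : ℍ := g • τ with hσ
  have hτ : g⁻¹ • σ = τ := inv_smul_smul g τ
  have hv : 0 < σ.im := σ.im_pos
  have h1 := hb g⁻¹ σ s hsa hsb hsT
  rw [hτ] at h1
  have h2 := sqrt_im_smul_mul_norm_denom g⁻¹ σ
  rw [hτ] at h2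
  obtain ⟨D, hD0, h1', h2'⟩ : ∃ D : ℝ, 0 < D ∧
      ‖eisensteinOneCont χ τ s‖ ≤ D * (C * (σ.im ^ A + σ.im ^ (-A))) ∧
      Real.sqrt τ.im * D = Real.sqrt σ.im :=
    ⟨_, norm_pos_iff.mpr (denom_ne_zero _ _), h1, h2⟩
  have hsqrt : Real.sqrt τ.im = Real.sqrt σ.im / D := by
    rw [← h2', mul_div_cancel_right₀ _ hD0.ne']
  have hsq : Real.sqrt σ.im = σ.im ^ (1 / 2 : ℝ) := Real.sqrt_eq_rpow σ.im
  have e1 : σ.im ^ (A + 1 / 2) ≤ σ.im ^ (A + 1 / 2) + σ.im ^ (-(A + 1 / 2)) := by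
    linarith [Real.rpow_nonneg hv.le (-(A + 1 / 2))]
  have e2 : σ.im ^ (-A + 1 / 2) ≤ σ.im ^ (A + 1 / 2) + σ.im ^ (-(A + 1 / 2)) :=
    rpow_le_rpow_add_rpow_neg hv (by rw [abs_le]; constructor <;> linarith)
  calc ‖eisensteinOneCont χ τ s‖ * Real.sqrt τ.im
      = ‖eisensteinOneCont χ τ s‖ * (Real.sqrt σ.im / D) := by rw [hsqrt]
    _ ≤ D * (C * (σ.im ^ A + σ.im ^ (-A))) * (Real.sqrt σ.im / D) :=
        mul_le_mul_of_nonneg_right h1' (by positivity)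
    _ = C * (σ.im ^ A + σ.im ^ (-A)) * Real.sqrt σ.im := by
        rw [show D * (C * (σ.im ^ A + σ.im ^ (-A))) * (Real.sqrt σ.im / D) =
          C * (σ.im ^ A + σ.im ^ (-A)) * Real.sqrt σ.im * (D / D) by ring, div_self hD0.ne', mul_one]
    _ = C * (σ.im ^ A + σ.im ^ (-A)) * σ.im ^ (1 / 2 : ℝ) := by rw [hsq]
    _ = C * (σ.im ^ (A + 1 / 2) + σ.im ^ (-A + 1 / 2)) := by
        rw [Real.rpow_add hv, Real.rpow_add hv]; ring
    _ ≤ C * (2 * (σ.im ^ (A + 1 / 2) + σ.im ^ (-(A + 1 / 2)))) :=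
        mul_le_mul_of_nonneg_left (by linarith) hC
    _ = 2 * C * (σ.im ^ (A + 1 / 2) + σ.im ^ (-(A + 1 / 2))) := by ring

/-- **Global polynomial bound**: for odd `χ` and a box in `s` there are `C, B ≥ 0` with
`‖G̃_χ(τ, s)‖ ≤ C ((Im τ)^B + (Im τ)^{-B})` for all `τ ∈ ℍ` (move `τ` into `𝒟` by some
`g ∈ SL(2, ℤ)`; there `1/2 < Im(gτ) ≤ max(Im τ, 1/Im τ)`). [folklore] -/
theorem exists_bound_eisensteinOneCont_global_box (hodd : χ.Odd) {a b T : ℝ} (ha : -1 / 2 < a)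
    (hab : a < b) (hT : 0 < T) :
    ∃ C B : ℝ, 0 ≤ C ∧ 0 ≤ B ∧ ∀ (τ : ℍ) (s : ℂ), a < s.re → s.re < b → |s.im| < T →
      ‖eisensteinOneCont χ τ s‖ ≤ C * (τ.im ^ B + τ.im ^ (-B)) := by
  obtain ⟨C, A, hC, hA, hb⟩ := exists_bound_eisensteinOneCont_mul_sqrt_box χ hodd ha hab hT
  refine ⟨2 * (C * (1 + 2 ^ A)), A + 1 / 2, by positivity, by positivity,
    fun τ s hsa hsb hsT => ?_⟩
  obtain ⟨g, hg⟩ := ModularGroup.exists_smul_mem_fd τ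
  set v : ℝ := (g • τ).im with hvdef
  set y : ℝ := τ.im with hydef
  have hy : 0 < y := τ.im_pos
  have hv2 : 1 / 2 < v := half_lt_im_of_mem_fd hg
  have hv : 0 < v := by linarith
  have h1 : ‖eisensteinOneCont χ τ s‖ * Real.sqrt y ≤ C * (v ^ A + v ^ (-A)) :=
    hb g τ s hsa hsb hsT
  -- `v^A ≤ y^A + y^{-A}` and `v^{-A} ≤ 2^A`
  have hvA : v ^ A ≤ y ^ A + y ^ (-A) := by
    have hle : v ≤ max y y⁻¹ := im_smul_le_max g τ
    calc v ^ A ≤ (max y y⁻¹) ^ A := Real.rpow_le_rpow hv.le hle hA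
      _ ≤ y ^ A + y ^ (-A) := by
          rcases le_total y y⁻¹ with h | h
          · rw [max_eq_right h, Real.inv_rpow hy.le, ← Real.rpow_neg hy.le]
            linarith [Real.rpow_nonneg hy.le A]
          · rw [max_eq_left h]
            linarith [Real.rpow_nonneg hy.le (-A)]
  have hvnA : v ^ (-A) ≤ 2 ^ A := by
    rw [Real.rpow_neg hv.le, ← Real.inv_rpow hv.le]
    refine Real.rpow_le_rpow (inv_nonneg.mpr hv.le) ?_ hA
    rw [inv_le_comm₀ hv two_pos]
    linarith
  have hone : 1 ≤ y ^ A + y ^ (-A) := by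
    rcases le_or_gt 1 y with h | h
    · have := Real.one_le_rpow h hA
      linarith [Real.rpow_nonneg hy.le (-A)]
    · have h' : 1 ≤ y ^ (-A) := by
        rw [Real.rpow_neg hy.le, ← Real.inv_rpow hy.le]
        exact Real.one_le_rpow ((one_le_inv₀ hy).mpr h.le) hA
      linarith [Real.rpow_nonneg hy.le A]
  have h2A : (0 : ℝ) ≤ 2 ^ A := by positivity
  have h2 : ‖eisensteinOneCont χ τ s‖ * Real.sqrt y ≤ C * (1 + 2 ^ A) * (y ^ A + y ^ (-A)) := by
    calc ‖eisensteinOneCont χ τ s‖ * Real.sqrt y ≤ C * (v ^ A + v ^ (-A)) := h1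
      _ ≤ C * ((y ^ A + y ^ (-A)) + 2 ^ A) := mul_le_mul_of_nonneg_left (add_le_add hvA hvnA) hC
      _ ≤ C * ((y ^ A + y ^ (-A)) + 2 ^ A * (y ^ A + y ^ (-A))) := by
          refine mul_le_mul_of_nonneg_left ?_ hC
          nlinarith
      _ = C * (1 + 2 ^ A) * (y ^ A + y ^ (-A)) := by ring
  -- divide by `√y = y^{1/2}`
  have hsq : Real.sqrt y = y ^ (1 / 2 : ℝ) := Real.sqrt_eq_rpow y
  have h3 : ‖eisensteinOneCont χ τ s‖ ≤
      C * (1 + 2 ^ A) * ((y ^ A + y ^ (-A)) * y ^ (-(1 / 2 : ℝ))) := by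
    have e : ‖eisensteinOneCont χ τ s‖ =
        ‖eisensteinOneCont χ τ s‖ * y ^ (1 / 2 : ℝ) * y ^ (-(1 / 2 : ℝ)) := by
      rw [mul_assoc, ← Real.rpow_add hy, add_neg_cancel, Real.rpow_zero, mul_one]
    rw [e]
    rw [hsq] at h2
    calc ‖eisensteinOneCont χ τ s‖ * y ^ (1 / 2 : ℝ) * y ^ (-(1 / 2 : ℝ))
        ≤ C * (1 + 2 ^ A) * (y ^ A + y ^ (-A)) * y ^ (-(1 / 2 : ℝ)) :=
          mul_le_mul_of_nonneg_right h2 (Real.rpow_nonneg hy.le _)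
      _ = _ := by ring
  have h4 : (y ^ A + y ^ (-A)) * y ^ (-(1 / 2 : ℝ)) ≤ 2 * (y ^ (A + 1 / 2) + y ^ (-(A + 1 / 2))) := by
    rw [add_mul, ← Real.rpow_add hy, ← Real.rpow_add hy]
    have e1 : y ^ (A + -(1 / 2 : ℝ)) ≤ y ^ (A + 1 / 2) + y ^ (-(A + 1 / 2)) :=
      rpow_le_rpow_add_rpow_neg hy (by rw [abs_le]; constructor <;> linarith)
    have e2 : y ^ (-A + -(1 / 2 : ℝ)) ≤ y ^ (A + 1 / 2) + y ^ (-(A + 1 / 2)) :=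
      rpow_le_rpow_add_rpow_neg hy (by rw [abs_le]; constructor <;> linarith)
    linarith
  calc ‖eisensteinOneCont χ τ s‖
      ≤ C * (1 + 2 ^ A) * ((y ^ A + y ^ (-A)) * y ^ (-(1 / 2 : ℝ))) := h3
    _ ≤ C * (1 + 2 ^ A) * (2 * (y ^ (A + 1 / 2) + y ^ (-(A + 1 / 2)))) :=
        mul_le_mul_of_nonneg_left h4 (by positivity)
    _ = 2 * (C * (1 + 2 ^ A)) * (y ^ (A + 1 / 2) + y ^ (-(A + 1 / 2))) := by ring

/-- The weight-one Eisenstein series at `s = 0` has moderate growth at every cusp: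
`‖G̃_χ(τ, 0)‖ (Im τ)^{1/2} ≤ C (v^A + v^{-A})`, `v = Im(gτ)`, for all `g, τ`. [folklore] -/
theorem exists_bound_eisensteinOneCont_zero_mul_sqrt (hodd : χ.Odd) :
    ∃ C A : ℝ, 0 ≤ C ∧ 0 ≤ A ∧ ∀ (g : SL(2, ℤ)) (τ : ℍ),
      ‖eisensteinOneCont χ τ 0‖ * Real.sqrt τ.im ≤ C * ((g • τ).im ^ A + (g • τ).im ^ (-A)) := by
  obtain ⟨C, A, hC, hA, hb⟩ := exists_bound_eisensteinOneCont_mul_sqrt_box χ hodd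
    (a := -1 / 4) (b := 1 / 4) (T := 1) (by norm_num) (by norm_num) one_pos
  refine ⟨C, A, hC, hA, fun g τ => hb g τ 0 ?_ ?_ ?_⟩
  · simp only [Complex.zero_re]; norm_num
  · simp only [Complex.zero_re]; norm_num
  · simp only [Complex.zero_im, abs_zero]; norm_num

end Growth

/-! ### Holomorphy of the Rankin–Selberg integral against `G̃_ψ` -/

section Holomorphy

/-- A ball around `s₀` (`Re s₀ > -1/2`) inside a conjugation-symmetric box `a < Re s < b`,
`|Im s| < T` with `a > -1/2`. [folklore] -/
theorem exists_box_of_re_gt {s₀ : ℂ} (hs₀ : -1 / 2 < s₀.re) :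
    ∃ a b T ε : ℝ, -1 / 2 < a ∧ a < b ∧ 0 < T ∧ 0 < ε ∧ ∀ s ∈ ball s₀ ε,
      (a < s.re ∧ s.re < b ∧ |s.im| < T) ∧
        (a < (conj s).re ∧ (conj s).re < b ∧ |(conj s).im| < T) := by
  refine ⟨(s₀.re - 1 / 2) / 2, s₀.re + 1, |s₀.im| + 1, min ((s₀.re + 1 / 2) / 2) 1,
    by linarith, by linarith, by positivity, lt_min (by linarith) one_pos, fun s hs => ?_⟩
  rw [mem_ball, dist_eq_norm] at hs
  have hre : |s.re - s₀.re| < min ((s₀.re + 1 / 2) / 2) 1 := by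
    have h := Complex.abs_re_le_norm (s - s₀)
    rw [Complex.sub_re] at h
    exact lt_of_le_of_lt h hs
  have him : |s.im - s₀.im| < min ((s₀.re + 1 / 2) / 2) 1 := by
    have h := Complex.abs_im_le_norm (s - s₀)
    rw [Complex.sub_im] at h
    exact lt_of_le_of_lt h hs
  have hre1 : |s.re - s₀.re| < (s₀.re + 1 / 2) / 2 := lt_of_lt_of_le hre (min_le_left _ _)
  have hre2 : |s.re - s₀.re| < 1 := lt_of_lt_of_le hre (min_le_right _ _)
  have him2 : |s.im - s₀.im| < 1 := lt_of_lt_of_le him (min_le_right _ _)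
  rw [abs_lt] at hre1 hre2 him2
  have hbox : (s₀.re - 1 / 2) / 2 < s.re ∧ s.re < s₀.re + 1 ∧ |s.im| < |s₀.im| + 1 := by
    refine ⟨by linarith, by linarith, ?_⟩
    calc |s.im| = |s₀.im + (s.im - s₀.im)| := by ring_nf
      _ ≤ |s₀.im| + |s.im - s₀.im| := abs_add_le _ _
      _ < |s₀.im| + 1 := by linarith [abs_lt.mpr him2]
  refine ⟨hbox, ?_⟩
  rw [Complex.conj_re, Complex.conj_im, abs_neg]
  exact hbox

variable {ι : Type*} [Fintype ι] (g : ι → SL(2, ℤ))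
variable {Γ : Subgroup (GL (Fin 2) ℝ)} [Γ.IsArithmetic]

/-- **Holomorphy on `Re s > -1/2` of `s ↦ ∫_F \overline{G̃_ψ(τ, s̄)} f(τ) \overline{F(τ)} y² dμ`**
for a weight-`2` cusp form `f` of arithmetic level, a measurable `F` of moderate growth at every
cusp, and an odd `ψ` (`F = ⋃_q g_q⁻¹ 𝒟ᵒ`). [folklore] -/
theorem differentiableOn_rsIntegral_eisensteinOneCont (f : CuspForm Γ 2) {F : ℍ → ℂ}
    (hFm : Measurable F)
    (hF : ∀ i, ∃ C A : ℝ, ∀ τ : ℍ, g i • τ ∈ 𝒟ᵒ →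
      ‖F τ‖ * Real.sqrt τ.im ≤ C * ((g i • τ).im ^ A + (g i • τ).im ^ (-A)))
    {N : ℕ} [NeZero N] (ψ : DirichletCharacter ℂ N) (hodd : ψ.Odd) :
    DifferentiableOn ℂ (fun s => ∫ τ in ⋃ i, {τ : ℍ | g i • τ ∈ 𝒟ᵒ},
      conj (eisensteinOneCont ψ τ (conj s)) * (f τ * conj (F τ) * ((τ.im : ℝ) : ℂ) ^ 2))
      {s : ℂ | -1 / 2 < s.re} := by
  have hχ : ψ ≠ 1 := ne_one_of_odd ψ hodd
  refine differentiableOn_integral_domain_rsKernel g f hFm hF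
    (E := fun τ s => eisensteinOneCont ψ τ s)
    (isOpen_lt continuous_const Complex.continuous_re) (fun s hs => by simpa using hs)
    (fun τ => differentiableOn_eisensteinOneCont ψ hχ τ)
    (fun s hs => (measurable_eisensteinOneCont ψ hodd hs).aestronglyMeasurable) ?_
  intro s₀ hs₀ i
  obtain ⟨a, b, T, ε, ha, hab, hT, hε, hbox⟩ := exists_box_of_re_gt hs₀
  obtain ⟨C, A, -, -, hb⟩ := exists_bound_eisensteinOneCont_mul_sqrt_box ψ hodd ha hab hT
  exact ⟨ε, hε, C, A, fun s hs τ _ =>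
    hb (g i) τ (conj s) (hbox s hs).2.1 (hbox s hs).2.2.1 (hbox s hs).2.2.2⟩

/-- **The case `F = G̃_{χ'}(·, 0)`** (a holomorphic weight-one Eisenstein series of any level `M'`,
odd `χ'`): `s ↦ ∫_F \overline{G̃_ψ(τ, s̄)} f(τ) \overline{G̃_{χ'}(τ, 0)} y² dμ` is holomorphic on
`Re s > -1/2`. [folklore] -/
theorem differentiableOn_rsIntegral_eisensteinOneCont_pair (f : CuspForm Γ 2) {M' : ℕ}
    [NeZero M'] (χ' : DirichletCharacter ℂ M') (hodd' : χ'.Odd) {N : ℕ} [NeZero N]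
    (ψ : DirichletCharacter ℂ N) (hodd : ψ.Odd) :
    DifferentiableOn ℂ (fun s => ∫ τ in ⋃ i, {τ : ℍ | g i • τ ∈ 𝒟ᵒ},
      conj (eisensteinOneCont ψ τ (conj s)) *
        (f τ * conj (eisensteinOneCont χ' τ 0) * ((τ.im : ℝ) : ℂ) ^ 2)) {s : ℂ | -1 / 2 < s.re} := by
  refine differentiableOn_rsIntegral_eisensteinOneCont g f
    (measurable_eisensteinOneCont χ' hodd' (s := 0) (by simp only [Complex.zero_re]; norm_num))
    (fun i => ?_) ψ hodd
  obtain ⟨C, A, -, -, hb⟩ := exists_bound_eisensteinOneCont_zero_mul_sqrt χ' hodd'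
  exact ⟨C, A, fun τ _ => hb (g i) τ⟩

end Holomorphy

end Literature.NumberTheory.EllipticCurves.ModularForms
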